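import Summits.QuantumFields.YangMills.Theorems.BalabanUVNodesPortS1JacobianLocal
import Literature.MathematicalPhysics.QuantumFieldTheory.Balaban1983to89.BlockAveragingEMLLinearisedBackground
import Literature.MathematicalPhysics.QuantumFieldTheory.Balaban1983to89.T3DescentFibreTower
import Literature.MathematicalPhysics.QuantumFieldTheory.Balaban1983to89.T4AdjointCovarianceUnitary
import Literature.Analysis.SpecialFunctions.LogFDeriv

/-!
# NODE O port PT-A — `LQ̃` OF RECORD AT THE FLAT BACKGROUND IS [B7] PROP. 3's LINEARISED AVERAGE: `Q̃(1, ·)` IS DIFFERENTIABLE AT `0` and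
# `(recordLQt 1 x)(c) = covLinAvg 1 (fluctMat x) c` — the (124) operator `Q₁(1)` of `BlockAveragingEMLLinearisedBackground` (the tree's kernel form of [Balaban1985Averaging] Prop. 3) read in
# DEF-1's coordinates; so at the base point the (2.11) carrier `recordLQt` (a `fderiv` of the exp-mean-log average composed with the series logarithm) is NOT junk and has print's value

Cell `ym-nodeO-ideate`, porter seat `ymgap-nodeO-port-PTA-1` (gen 4); `--supports stmt-QuantumFields-27930` (helper; K7-c «flat = print at the base point» for the constraint linearisation `LQ̃` of
[I] p.267).  [I] = [Balaban1987RG1], [B7] = [Balaban1985Averaging].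
THE ARGUMENT.  `Q̃(1, B′)(c) = mlog(M(exp(B′)·1)(c) · M(1)(c)⁻¹)` with `M = avgFun expMeanLogSU` ((0.4) of record), `M(1) = 1`.  [B7] Prop. 3 (122)–(124) at the background `U₀ = 1` (all loop variables
`= 1`, so `α = 0`): `‖M(U)(c) − 1 − Q₁(1)(Y)(c)‖ ≤ 400·(ℓ‖Y‖)²`, `Y_b = U_b − 1 = exp(B′_b) − 1`, `ℓ = (d+2)L` (`norm_avgFun_ratio_sub_one_sub_covLinAvg_le`) — a genuine second-order remainder;
`Y` is differentiable at `B′ = 0` with derivative `B′ ↦ (b ↦ Σ_a B′(b,a) su2Gen a)` (`exp′(0) = id`), `Q₁(1)` is linear, and `mlog′(1) = id` (`LogFDeriv.hasFDerivAt_logOnePlus_sub_one`,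
`norm_tsum_term_sub_id_le`); the chain rule assembles `D Q̃(1, ·)(0) = Q₁(1) ∘ fluctMat`.
* §1 algebra at the flat background: `star_su2Gen`, `trace_su2Gen`, `fluctMat_mem_lieSU`, `exp_fluctMat_mem`, `coe_pert_one`, `pertVar_one_pert`, `pert_zero`, `avOfRecord_avg_one`, `recordQt_one_apply`;
  linearity of `fluctMat` and of `covLinAvg 1 (·) c`.
* §2 ★★ `differentiableAt_recordQt_one_and_recordLQt_one_apply` — `DifferentiableAt ℝ (recordQt F k K 1) 0 ∧ ∀ x c, recordLQt F k K 1 x c = covLinAvg 1 (fun b => fluctMat F k K x b) c`.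

HONEST FRAMING.  Calculus at the FLAT background only (the base point of the chart); NOTHING of Bałaban's estimates beyond the tree's own [B7] Prop. 3 kernel theorem is used or asserted; the
letter `RecordB0BlockInvertible F k K 1` is NOT proved here (it needs the central-bond count of `Q₁(1)`, next); 27930 OPEN; K0⁷∕K-Ax OPEN; NODE O 0∕1; COUNT 8∕28 · K 1∕4 UNMOVED; finite
`𝕋⁴_{L^K}` at fixed ε — NOT continuum ∕ OS ∕ Clay; **the Yang–Mills mass gap is NOT proved by any of this.**  No `sorry`, no `def`, no `instance`; standard axioms.
-/

noncomputable section

open scoped BigOperators Matrix.Norms.L2Operator Topology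

namespace Summit.QuantumFields.YangMills.Theorems.BalabanUVNodesPortS1

open Summit.QuantumFields.YangMills.Theorems.K0RecordFormatNames
open Literature.MathematicalPhysics.QuantumFieldTheory.Balaban1983to89
open Literature.MathematicalPhysics.QuantumFieldTheory.Balaban1983to89.Node00
open Literature.MathematicalPhysics.QuantumFieldTheory.Balaban1983to89.T4Continuum (T4Family)
open Literature.MathematicalPhysics.QuantumFieldTheory.Balaban1983to89.BlockAveraging (avgFun)
open Literature.MathematicalPhysics.QuantumFieldTheory.Balaban1983to89.ExpMeanLog (expMeanLogSU)
open Literature.MathematicalPhysics.QuantumFieldTheory.Balaban1983to89.BlockAveragingEMLLinearisedBackground (covLinAvg pertVar covWalkSum)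
open NormedSpace (exp)
open _root_.Matrix _root_.Filter _root_.Asymptotics

variable (F : T4Family)

/-! ## §1  Algebra at the flat background -/

/-- The 𝔰𝔲(2) basis matrices are anti-Hermitian. [folklore] -/
theorem star_su2Gen (a : Fin 3) : star (su2Gen a) = -su2Gen a := by
  fin_cases a <;>
  · ext i j
    fin_cases i <;> fin_cases j <;> simp [su2Gen, Matrix.star_apply]

/-- The 𝔰𝔲(2) basis matrices are traceless. [folklore] -/
theorem trace_su2Gen (a : Fin 3) : (su2Gen a).trace = 0 := by
  fin_cases a <;> simp [su2Gen, Matrix.trace, Fin.sum_univ_two]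

/-- `fluctMat x b = Σ_a x(b,a) su2Gen a` lies in 𝔰𝔲(2). [cite: Balaban1987RG1, (2.4) p.266 (bookkeeping)] -/
theorem fluctMat_mem_lieSU (k K : ℕ) (x : FluctIdx F k K → ℝ) (b : PBond (F.P K) k) :
    fluctMat F k K x b ∈ T4AdjointCovarianceUnitary.lieSU (Fin 2) := by
  rw [T4AdjointCovarianceUnitary.mem_lieSU_iff, fluctMat]
  constructor
  · rw [star_sum, ← Finset.sum_neg_distrib]
    refine Finset.sum_congr rfl fun a _ => ?_
    rw [star_smul, star_su2Gen, Complex.star_def, Complex.conj_ofReal, smul_neg]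
  · rw [Matrix.trace_sum]
    exact Finset.sum_eq_zero fun a _ => by rw [Matrix.trace_smul, trace_su2Gen, smul_zero]

/-- `exp(fluctMat x b) ∈ SU(2)`. [cite: Balaban1987RG1, (2.4) p.266 («V′ = exp(iB′)»)] -/
theorem exp_fluctMat_mem (k K : ℕ) (x : FluctIdx F k K → ℝ) (b : PBond (F.P K) k) :
    exp (fluctMat F k K x b) ∈ Matrix.specialUnitaryGroup (Fin 2) ℂ :=
  T4AdjointCovarianceUnitary.exp_mem_specialUnitaryGroup_of_mem_lieSU (fluctMat_mem_lieSU F k K x b)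

/-- The unit configuration evaluated at a bond (bookkeeping). [folklore] -/
theorem gaugeField_one_apply (k K : ℕ) (b : PBond (F.P K) k) : (1 : GaugeField (F.P K) k (SU 2)) b = 1 := rfl

/-- At the flat background the perturbed configuration IS `exp(B′)`: `(pert 1 x b : M₂(ℂ)) = exp(fluctMat x b)`. [cite: Balaban1987RG1, (2.4) p.266] -/
theorem coe_pert_one (k K : ℕ) (x : FluctIdx F k K → ℝ) (b : PBond (F.P K) k) :
    ((pert F k K (1 : GaugeField (F.P K) k (SU 2)) x b : SU 2) : MatA 2) = exp (fluctMat F k K x b) := by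
  rw [pert, gaugeField_one_apply, mul_one, suOfMat_of_mem (exp_fluctMat_mem F k K x b)]

/-- The [B7] perturbation variable of `exp(B′)·1` over `1`: `Y_b = exp(fluctMat x b) − 1`. [cite: Balaban1985Variational, (15) p.280; Balaban1987RG1, (2.4) p.266] -/
theorem pertVar_one_pert (k K : ℕ) (x : FluctIdx F k K → ℝ) (b : PBond (F.P K) k) :
    pertVar (1 : GaugeField (F.P K) k (SU 2)) (pert F k K 1 x) b = exp (fluctMat F k K x b) - 1 := by
  rw [pertVar, gaugeField_one_apply, inv_one, mul_one, coe_pert_one]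

/-- `fluctMat 0 = 0`. [folklore] -/
theorem fluctMat_zero (k K : ℕ) (b : PBond (F.P K) k) : fluctMat F k K 0 b = 0 := by
  simp [fluctMat]

/-- `pert Vk 0 = Vk`. [cite: Balaban1987RG1, (2.4) p.266 (bookkeeping)] -/
theorem pert_zero (k K : ℕ) (Vk : GaugeField (F.P K) k (SU 2)) : pert F k K Vk 0 = Vk := by
  funext b
  rw [pert, fluctMat_zero, NormedSpace.exp_zero, suOfMat_of_mem (Submonoid.one_mem _)]
  exact one_mul _

/-- The averaging of record fixes the unit configuration: `M(1) = 1`. [cite: Balaban1987RG1, (0.4) p.253] -/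
theorem avOfRecord_avg_one (K k : ℕ) : (avOfRecord F 2 K k).avg (1 : GaugeField (F.P K) k (SU 2)) = 1 := by
  rw [avOfRecord_avg]
  exact T3DescentFibreTower.avgFun_one _ T3DescentFibreTower.expMeanLogSU_E_one

/-- `Q̃(1, B′)(c) = mlog (M(exp(B′))(c))` at the flat background. [cite: Balaban1987RG1, p.267, (0.4) p.253] -/
theorem recordQt_one_apply (k K : ℕ) (x : FluctIdx F k K → ℝ) (c : PBond (F.P K) (k + 1)) :
    recordQt F k K (1 : GaugeField (F.P K) k (SU 2)) x c = MatrixLog.mlog ((avgFun expMeanLogSU (pert F k K 1 x) c : SU 2) : MatA 2) := by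
  have h1 : (avOfRecord F 2 K k).avg (1 : GaugeField (F.P K) k (SU 2)) c = 1 := by rw [avOfRecord_avg_one]; rfl
  rw [recordQt, h1, inv_one, mul_one, avOfRecord_avg]

/-- `fluctMat` is additive in the coordinates. [folklore] -/
theorem fluctMat_add (k K : ℕ) (x y : FluctIdx F k K → ℝ) (b : PBond (F.P K) k) :
    fluctMat F k K (x + y) b = fluctMat F k K x b + fluctMat F k K y b := by
  simp [fluctMat, add_smul, Finset.sum_add_distrib]

/-- `fluctMat` is ℝ-homogeneous in the coordinates. [folklore] -/
theorem fluctMat_smul (k K : ℕ) (t : ℝ) (x : FluctIdx F k K → ℝ) (b : PBond (F.P K) k) :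
    fluctMat F k K (t • x) b = t • fluctMat F k K x b := by
  simp only [fluctMat, Pi.smul_apply, smul_eq_mul, Complex.ofReal_mul, Finset.smul_sum]
  refine Finset.sum_congr rfl fun a _ => ?_
  rw [mul_smul, Complex.coe_smul]

/-- `Q₁(U₀)` is additive in `Y`. [cite: Balaban1985Averaging, (124) p.36 (bookkeeping)] -/
theorem covLinAvg_add {K k : ℕ} (U₀ : GaugeField (F.P K) k (SU 2)) (Y Y' : PBond (F.P K) k → MatA 2) (c : PBond (F.P K) (k + 1)) :
    covLinAvg U₀ (Y + Y') c = covLinAvg U₀ Y c + covLinAvg U₀ Y' c := by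
  simp only [covLinAvg, BlockAveragingEMLLinearisedBackground.covWalkSum_add, Finset.sum_add_distrib, smul_add]
  abel

/-- `Q₁(U₀)` is ℝ-homogeneous in `Y`. [cite: Balaban1985Averaging, (124) p.36 (bookkeeping)] -/
theorem covLinAvg_smul {K k : ℕ} (U₀ : GaugeField (F.P K) k (SU 2)) (t : ℝ) (Y : PBond (F.P K) k → MatA 2) (c : PBond (F.P K) (k + 1)) :
    covLinAvg U₀ (t • Y) c = t • covLinAvg U₀ Y c := by
  have hM : ∀ M : MatA 2, t • M = ((t : ℂ)) • M := fun M => (Complex.coe_smul t M).symm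
  have ht : t • Y = ((t : ℂ)) • Y := by funext b; simp only [Pi.smul_apply, hM]
  rw [ht, hM, covLinAvg, covLinAvg, smul_add, smul_comm ((t : ℂ)) (((Fintype.card (BlockAveraging.Idx (F.P K)) : ℂ))⁻¹)]
  simp only [BlockAveragingEMLLinearisedBackground.covWalkSum_smul, ← Finset.smul_sum]


/-! ## §2  ★★ `Q̃(1, ·)` is differentiable at `0` and `LQ̃(1) = Q₁(1) ∘ fluctMat` -/

open Classical in
/-- ★★ **`LQ̃` OF RECORD AT THE FLAT BACKGROUND = [B7] PROP. 3's LINEARISED AVERAGE `Q₁(1)`**: `Q̃(1, ·) = recordQt F k K 1` is (Fréchet-)differentiable at `B′ = 0`, and its derivative —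
DEF-1's `recordLQt F k K 1` — is `x ↦ (c ↦ covLinAvg 1 (fluctMat x) c)`: the mean over the (0.4) index set of the signed sums of `B′` along the loop words plus the signed sum along the straight
segment of `c`, [Balaban1985Averaging] (124) at `U₀ = 1`.  (Second-order remainder from the tree's Prop. 3 kernel theorem at `α = 0`; `exp′(0) = id`, `mlog′(1) = id`, chain rule.)
[cite: Balaban1987RG1, p.267 («L is a linear transformation»), (0.4) p.253; Balaban1985Averaging, Prop. 3 (122)–(124) p.36] -/
theorem differentiableAt_recordQt_one_and_recordLQt_one_apply (k K : ℕ) :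
    DifferentiableAt ℝ (recordQt F k K (1 : GaugeField (F.P K) k (SU 2))) 0 ∧
      ∀ (x : FluctIdx F k K → ℝ) (c : PBond (F.P K) (k + 1)),
        recordLQt F k K (1 : GaugeField (F.P K) k (SU 2)) x c =
          covLinAvg (1 : GaugeField (F.P K) k (SU 2)) (fun b => fluctMat F k K x b) c := by
  -- the coordinate map `x ↦ fluctMat x` and the linearised average `Y ↦ Q₁(1)(Y)(c)` as continuous linear maps
  let Alin : (FluctIdx F k K → ℝ) →ₗ[ℝ] (PBond (F.P K) k → MatA 2) :=
    { toFun := fun x b => fluctMat F k K x b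
      map_add' := fun x y => funext fun b => fluctMat_add F k K x y b
      map_smul' := fun t x => funext fun b => fluctMat_smul F k K t x b }
  let A : (FluctIdx F k K → ℝ) →L[ℝ] (PBond (F.P K) k → MatA 2) := LinearMap.toContinuousLinearMap Alin
  have hA : ∀ x b, A x b = fluctMat F k K x b := fun x b => rfl
  let Φlin : PBond (F.P K) (k + 1) → ((PBond (F.P K) k → MatA 2) →ₗ[ℝ] MatA 2) := fun c =>
    { toFun := fun Y => covLinAvg (1 : GaugeField (F.P K) k (SU 2)) Y c
      map_add' := fun Y Y' => covLinAvg_add F 1 Y Y' c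
      map_smul' := fun t Y => covLinAvg_smul F 1 t Y c }
  let Φ : PBond (F.P K) (k + 1) → ((PBond (F.P K) k → MatA 2) →L[ℝ] MatA 2) := fun c => LinearMap.toContinuousLinearMap (Φlin c)
  have hΦ : ∀ c Y, Φ c Y = covLinAvg (1 : GaugeField (F.P K) k (SU 2)) Y c := fun c Y => rfl
  -- the [B7] perturbation variable `Y_b = exp(B′_b) − 1` as a function of the coordinates; derivative `A` at `0`
  let Yf : (FluctIdx F k K → ℝ) → (PBond (F.P K) k → MatA 2) := fun x b => exp (fluctMat F k K x b) - 1
  have hYf : ∀ x, pertVar (1 : GaugeField (F.P K) k (SU 2)) (pert F k K 1 x) = Yf x := fun x => funext fun b => pertVar_one_pert F k K x b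
  have hY0 : Yf 0 = 0 := by
    funext b
    show exp (fluctMat F k K 0 b) - 1 = 0
    rw [fluctMat_zero, NormedSpace.exp_zero, sub_self]
  have hYd : HasFDerivAt Yf A 0 := by
    have hpi : HasFDerivAt (fun x b => exp (fluctMat F k K x b) - 1) (ContinuousLinearMap.pi fun b => (ContinuousLinearMap.proj b).comp A) 0 := by
      rw [hasFDerivAt_pi]
      intro b
      have hAb : HasFDerivAt (fun x : FluctIdx F k K → ℝ => A x b) ((ContinuousLinearMap.proj b).comp A) 0 :=
        ((ContinuousLinearMap.proj b).comp A).hasFDerivAt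
      have hexp : HasFDerivAt (exp : MatA 2 → MatA 2) ((1 : MatA 2 →L[ℂ] MatA 2).restrictScalars ℝ) (A 0 b) := by
        rw [map_zero, Pi.zero_apply]
        exact (hasFDerivAt_exp_zero (𝕂 := ℂ)).restrictScalars ℝ
      have hcomp := (hexp.comp (0 : FluctIdx F k K → ℝ) hAb).sub_const (1 : MatA 2)
      have hder : ((1 : MatA 2 →L[ℂ] MatA 2).restrictScalars ℝ).comp ((ContinuousLinearMap.proj b).comp A) = (ContinuousLinearMap.proj b).comp A := by
        ext v; rfl
      rw [hder] at hcomp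
      exact hcomp
    have hpi_eq : (ContinuousLinearMap.pi fun b => (ContinuousLinearMap.proj b).comp A) = A := by
      ext v b; rfl
    rw [hpi_eq] at hpi
    exact hpi
  have hYcont : Tendsto (fun x => ‖Yf x‖) (𝓝 0) (𝓝 0) := by
    have h := (continuous_norm.continuousAt.tendsto.comp hYd.continuousAt.tendsto)
    simpa [Function.comp_def, hY0] using h
  -- `mlog′(1) = id`
  have hmlog : HasFDerivAt (MatrixLog.mlog : MatA 2 → MatA 2) ((ContinuousLinearMap.id ℂ (MatA 2)).restrictScalars ℝ) 1 := by
    have h := Literature.Analysis.SpecialFunctions.LogFDeriv.hasFDerivAt_logOnePlus_sub_one (X := (1 : MatA 2)) (by simp)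
    have hD : (∑' n, Literature.Analysis.SpecialFunctions.LogFDeriv.term ((1 : MatA 2) - 1) n) = ContinuousLinearMap.id ℂ (MatA 2) := by
      rw [sub_self]
      have hle := Literature.Analysis.SpecialFunctions.LogFDeriv.norm_tsum_term_sub_id_le (x := (0 : MatA 2)) (by simp)
      rw [norm_zero, zero_div] at hle
      exact sub_eq_zero.mp (norm_le_zero_iff.mp hle)
    rw [hD] at h
    exact h.restrictScalars ℝ
  -- the letters `ℓ = (d+2)L` and the small-field radius
  set ℓ : ℝ := ((((F.P K).d + 2) * (F.P K).L : ℕ) : ℝ) with hℓ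
  have hδSU := ExpMeanLog.deltaSU_pos (n := Fin 2)
  -- per coarse bond: the Prop. 3 remainder ⇒ `W_c(x) := M(exp B′)(c)` has derivative `Φ c ∘ A` at `0`
  have hW : ∀ c : PBond (F.P K) (k + 1),
      HasFDerivAt (fun x : FluctIdx F k K → ℝ => ((avgFun expMeanLogSU (pert F k K 1 x) c : SU 2) : MatA 2)) ((Φ c).comp A) 0 := by
    intro c
    set W : (FluctIdx F k K → ℝ) → MatA 2 := fun x => ((avgFun expMeanLogSU (pert F k K 1 x) c : SU 2) : MatA 2) with hWdef
    have havg1 : (avgFun expMeanLogSU (1 : GaugeField (F.P K) k (SU 2)) c : SU 2) = 1 := by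
      rw [T3DescentFibreTower.avgFun_one _ T3DescentFibreTower.expMeanLogSU_E_one]; rfl
    have hW0 : W 0 = 1 := by
      show ((avgFun expMeanLogSU (pert F k K 1 0) c : SU 2) : MatA 2) = 1
      rw [pert_zero, havg1]; rfl
    -- Prop. 3 at `U₀ = 1`, `α = 0`, eventually in `x`
    have hev48 : ∀ᶠ x : FluctIdx F k K → ℝ in 𝓝 0, 48 * (ℓ * ‖Yf x‖) ≤ 1 := by
      have ht : Tendsto (fun x => 48 * (ℓ * ‖Yf x‖)) (𝓝 0) (𝓝 (48 * (ℓ * 0))) := (hYcont.const_mul ℓ).const_mul 48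
      rw [mul_zero, mul_zero] at ht
      exact (ht.eventually_lt_const zero_lt_one).mono fun x hx => hx.le
    have hevN : ∀ᶠ x : FluctIdx F k K → ℝ in 𝓝 0, 2 * (ℓ * ‖Yf x‖) + 0 < ExpMeanLog.deltaSU (Fin 2) := by
      have ht : Tendsto (fun x => 2 * (ℓ * ‖Yf x‖) + 0) (𝓝 0) (𝓝 (2 * (ℓ * 0) + 0)) := ((hYcont.const_mul ℓ).const_mul 2).add_const 0
      rw [mul_zero, mul_zero, add_zero] at ht
      exact ht.eventually_lt_const hδSU
    have hbound : ∀ᶠ x : FluctIdx F k K → ℝ in 𝓝 0, ‖W x - 1 - Φ c (Yf x)‖ ≤ (400 * ℓ ^ 2) * ‖‖Yf x‖ ^ 2‖ := by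
      filter_upwards [hev48, hevN] with x h48 hN
      have hP := BlockAveragingEMLLinearisedBackground.norm_avgFun_ratio_sub_one_sub_covLinAvg_le (n := Fin 2) (1 : GaugeField (F.P K) k (SU 2)) (pert F k K 1 x)
        (δ := ‖Yf x‖) (α := 0) (norm_nonneg _) (fun b => by rw [hYf]; exact norm_le_pi_norm (Yf x) b) h48 c
        (fun i => by rw [T3DescentFibreTower.loopHol_one, GaugeGroup.dist1_one]) (by norm_num) hN
      rw [havg1, hYf] at hP
      have hstar : star (((1 : SU 2) : MatA 2)) = 1 := by rw [OneMemClass.coe_one, star_one]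
      rw [hstar, mul_one] at hP
      rw [Real.norm_of_nonneg (sq_nonneg _)]
      calc ‖W x - 1 - Φ c (Yf x)‖ ≤ 400 * (ℓ * ‖Yf x‖) * (ℓ * ‖Yf x‖ + 0) := hP
        _ = (400 * ℓ ^ 2) * ‖Yf x‖ ^ 2 := by ring
    have e1 : (fun x => W x - 1 - Φ c (Yf x)) =O[𝓝 0] (fun x => ‖Yf x‖ ^ 2) := IsBigO.of_bound _ hbound
    have e2 : (fun x : FluctIdx F k K → ℝ => ‖Yf x‖ ^ 2) =o[𝓝 0] (fun x => x) := by
      have hO : (fun x => ‖Yf x‖) =O[𝓝 0] (fun x : FluctIdx F k K → ℝ => ‖x‖) := by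
        have h := hYd.isBigO_sub
        simp only [hY0, sub_zero] at h
        exact h.norm_norm
      have ho : (fun x => ‖Yf x‖) =o[𝓝 0] (fun _ : FluctIdx F k K → ℝ => (1 : ℝ)) := (isLittleO_one_iff ℝ).mpr hYcont
      have h := hO.mul_isLittleO ho
      simp only [mul_one] at h
      have h' : (fun x : FluctIdx F k K → ℝ => ‖Yf x‖ ^ 2) =o[𝓝 0] (fun x : FluctIdx F k K → ℝ => ‖x‖) := by
        refine h.congr_left fun x => ?_
        ring
      exact isLittleO_norm_right.mp h'
    have e3 : (fun x => Φ c (Yf x) - (Φ c).comp A x) =o[𝓝 0] (fun x => x) := by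
      have h := ((Φ c).hasFDerivAt.comp (0 : FluctIdx F k K → ℝ) hYd).isLittleO
      simpa [Function.comp_def, hY0, sub_zero] using h
    have htot := (e1.trans_isLittleO e2).add e3
    rw [hasFDerivAt_iff_isLittleO_nhds_zero]
    refine htot.congr_left fun x => ?_
    simp only [zero_add, hW0]
    abel
  -- per coarse bond: `Q̃(1, x)(c) = mlog (W_c x)` has derivative `Φ c ∘ A` (`mlog′(1) = id`)
  have hQ : ∀ c : PBond (F.P K) (k + 1),
      HasFDerivAt (fun x : FluctIdx F k K → ℝ => recordQt F k K (1 : GaugeField (F.P K) k (SU 2)) x c) ((Φ c).comp A) 0 := by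
    intro c
    have hfun : (fun x : FluctIdx F k K → ℝ => recordQt F k K (1 : GaugeField (F.P K) k (SU 2)) x c) =
        (MatrixLog.mlog : MatA 2 → MatA 2) ∘ fun x => ((avgFun expMeanLogSU (pert F k K 1 x) c : SU 2) : MatA 2) := by
      funext x
      exact recordQt_one_apply F k K x c
    have h0 : ((avgFun expMeanLogSU (pert F k K 1 (0 : FluctIdx F k K → ℝ)) c : SU 2) : MatA 2) = 1 := by
      rw [pert_zero, T3DescentFibreTower.avgFun_one _ T3DescentFibreTower.expMeanLogSU_E_one]; rfl
    have hm : HasFDerivAt (MatrixLog.mlog : MatA 2 → MatA 2) ((ContinuousLinearMap.id ℂ (MatA 2)).restrictScalars ℝ)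
        ((fun x : FluctIdx F k K → ℝ => ((avgFun expMeanLogSU (pert F k K 1 x) c : SU 2) : MatA 2)) 0) := by
      beta_reduce; rw [h0]; exact hmlog
    have hcomp := hm.comp (0 : FluctIdx F k K → ℝ) (hW c)
    have hid : ((ContinuousLinearMap.id ℂ (MatA 2)).restrictScalars ℝ).comp ((Φ c).comp A) = (Φ c).comp A := by
      ext v; rfl
    rw [hid, ← hfun] at hcomp
    exact hcomp
  -- assemble
  have hpi : HasFDerivAt (fun x c => recordQt F k K (1 : GaugeField (F.P K) k (SU 2)) x c) (ContinuousLinearMap.pi fun c => (Φ c).comp A) 0 :=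
    hasFDerivAt_pi.mpr hQ
  refine ⟨hpi.differentiableAt, fun x c => ?_⟩
  rw [recordLQt, hpi.fderiv]
  rfl

end Summit.QuantumFields.YangMills.Theorems.BalabanUVNodesPortS1

end
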